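import Summits.CriticalPhenomena.PercolationContinuityZ3.Theorems.Transplant.KNLevelsLocality
import HarnessLib

/-!
# F5 (generic), part 3 — Kozma–Nitzan Lemma 10, STEP II over levels: the one-level estimate (18), `P(A_t) ≤ (1-(1-p)^{ΔN})^t`, counting
# failure levels, and Step II (generalises `L/KozmaNitzanTargetLemma.lean` ll. 899–1270 from `zdGraph d` to a graph with levels)

builds on p205010 (kernel theorem, internal audit signed; external expert review pending) — nothing in this file uses p205010.
Lane `prim-bschramm`, seat `prim-bschramm-p3` (task F5-prod); helper file (`--supports stmt-CriticalPhenomena-4575 --as helper`).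

Continuation of `KNLevelsDefs` / `KNLevelsLocality` (BLUEPRINT-I-PHI §1: "Step II counts ALL contacts (direction-blind)"; §3 Φ6).  Over a
locally finite graph `G` with degrees `≤ Δ` (KN: `2d`; for `X □ ℤ²`: `Δ_X + 4`, p2's `ProdKN.degree_prod_le`) and countably many vertices:
* `LHyp.real_Hev_inter_Djo_le` — **(18)**: `P(H_{t,j} ∩ D_j) ≤ (1 - (1-p)^{ΔN}) · P(H_{t,j})` (condition on the contact set; the `< N` contact
  vertices have `≤ ΔN` fresh contact edges of weight `p`, independent of the exploration outside `B⟨j⟩`);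
* `LHyp.real_Aev_le` — `P(A_t) ≤ (1 - (1-p)^{ΔN})^t` ((17)–(18));
* `LHyp.reachB_inter_subset_Aev` — on `{o ↔ B}`, `t` failure levels give `A_t` (a.s.);
* `LData.sum_real_inter_Fail_eq` — `Σ_j P(C ∩ Fail_j) = Σ_{t ≥ 1} P(C ∩ {t ≤ #failures})`;
* `LHyp.stepII` — **Step II**: if `P(o ↔ B) > 1 - δ` and the level range `[j₀, j₁]`, `j₁ ≤ R`, has at least `(1-p)^{-ΔN}/δ` levels, then at
  some level there are `≥ N` contact vertices with probability `> 1 - 2δ` (stated with the event `{N ≤ #Kont_j} = (Fail N j)ᶜ`).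
Proofs: the original's, line by line (`2 * d` ↦ `Δ`, box arithmetic ↦ the level axioms of `LHyp`).

[cite: KozmaNitzan2024, §4 Lemma 10, p. 18 (Step II, (17)–(18)) — the ℤ^d model] [cite: GrimmettPercolation1999, §7.2]
-/

noncomputable section

open MeasureTheory ProbabilityTheory
open scoped ENNReal

namespace Summit.CriticalPhenomena.PercolationContinuityZ3.Theorems

namespace Transplant

namespace KNLevels

open Literature.Probability.Percolation Literature.Probability.LatticeModels SimpleGraph

variable {V : Type*} [DecidableEq V] {G : SimpleGraph V} [G.LocallyFinite]

namespace LHyp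

variable {L : LData G} {W : Sym2 V → unitInterval} {p : unitInterval} {D : Finset V} {R : ℕ}
variable (hL : LHyp L W p D R)
include hL

/-- **The one-level estimate** `P(H_{t,j} ∩ D_j) ≤ (1 - (1-p)^{ΔN}) · P(H_{t,j})` (eq. (18)): condition on the contact set `κ` (fewer
than `N` vertices on `H_{t,j} ⊆ Fail_j`); `H_{t,j} ∩ {Kont = κ}` is determined by the pairs outside `B⟨j⟩`, the contact edges of `κ` are at
most `ΔN` fresh edges of `G` of weight `p`. [cite: KozmaNitzan2024, §4 p. 18 ((18))] -/
theorem real_Hev_inter_Djo_le {Δ : ℕ} (hΔ : ∀ x, G.degree x ≤ Δ) {N : ℕ} {J : Finset ℕ} (hJ : ∀ j' ∈ J, j' ≤ R)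
    {t j : ℕ} (hj : j ∈ J) :
    (prodBernoulli W).real (L.Hev N J t j ∩ L.Djo j) ≤
      (1 - (1 - (p : ℝ)) ^ (Δ * N)) * (prodBernoulli W).real (L.Hev N J t j) := by
  classical
  set μ := prodBernoulli W with hμ
  set r : ℝ := 1 - (1 - (p : ℝ)) ^ (Δ * N) with hr
  have hjR : j ≤ R := hJ j hj
  set OB := outerBoundary G (L.X j) with hOB
  -- the pieces
  set B : Finset V → Set (BondConfig V) := fun κ => L.Hev N J t j ∩ {ω | L.Kont j ω = κ} with hB
  set Op : Finset V → Set (BondConfig V) := fun κ => {ω | ∃ e ∈ L.cEdges j κ, e ∈ ω} with hOp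
  have hBdet : ∀ κ, DeterminedBy (B κ) (wireSet (L.region j)) := by
    intro κ
    rw [determinedBy_iff]
    intro ω ω' hω
    have h1 : ∀ e ∈ wireSet (L.region j), e ∈ ω ↔ e ∈ ω' := fun e he => by
      have := Set.ext_iff.1 hω e
      simp only [Set.mem_inter_iff] at this
      exact ⟨fun h' => (this.1 ⟨h', he⟩).1, fun h' => (this.2 ⟨h', he⟩).1⟩
    simp only [hB, Set.mem_inter_iff, Set.mem_setOf_eq]
    rw [(determinedBy_iff _ _).1 (hL.determinedBy_Hev hJ t j) ω ω' hω, LData.Kont_congr h1]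
  have hBm : ∀ κ, MeasurableSet (B κ) := fun κ =>
    ((hBdet κ).mono fun _ he => Finset.mem_coe.2 (L.mem_pairsF_of_mem_wireSet_region he)).measurableSet_of_finset
  have hOpdet : ∀ κ, DeterminedBy (Op κ) (↑(L.cEdges j κ) : Set (Sym2 V)) := by
    intro κ
    rw [determinedBy_iff]
    intro ω ω' hω
    simp only [hOp, Set.mem_setOf_eq]
    refine exists_congr fun e => and_congr_right fun he => ?_
    have := Set.ext_iff.1 hω e
    simp only [Set.mem_inter_iff, Finset.mem_coe] at this
    exact ⟨fun h' => (this.1 ⟨h', he⟩).1, fun h' => (this.2 ⟨h', he⟩).1⟩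
  have hOpm : ∀ κ, MeasurableSet (Op κ) := fun κ => (hOpdet κ).measurableSet_of_finset
  -- `P(Op κ) ≤ r` when `κ ⊆ ∂B⟨j⟩` has fewer than `N` vertices
  have hOp_le : ∀ κ, κ ⊆ OB → κ.card < N → μ.real (Op κ) ≤ r := by
    intro κ hκ hcard
    have hcompl : Op κ = {ω | ∀ e ∈ L.cEdges j κ, e ∉ ω}ᶜ := by
      ext ω; simp [hOp]
    have hclosed : μ.real {ω | ∀ e ∈ L.cEdges j κ, e ∉ ω} = (1 - (p : ℝ)) ^ (L.cEdges j κ).card := by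
      rw [hμ, prodBernoulli_real_forall_notMem W (L.cEdges j κ)]
      rw [Finset.prod_congr rfl fun e he => by rw [hL.W_cEdge hjR hκ he], Finset.prod_const]
    have hmeas : MeasurableSet {ω : BondConfig V | ∀ e ∈ L.cEdges j κ, e ∉ ω} :=
      measurableSet_forall_notMem_of_countable (L.cEdges j κ).countable_toSet
    rw [hcompl, measureReal_compl hmeas, probReal_univ, hclosed, hr]
    have hp0 : (0 : ℝ) ≤ 1 - p := sub_nonneg.2 p.2.2
    have hp1' : 1 - (p : ℝ) ≤ 1 := sub_le_self _ p.2.1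
    have hle : (L.cEdges j κ).card ≤ Δ * N :=
      (LData.card_cEdges_le hΔ j κ).trans (Nat.mul_le_mul_left _ hcard.le)
    linarith [pow_le_pow_of_le_one hp0 hp1' hle]
  -- decompositions over `κ`
  have hdecH : L.Hev N J t j = ⋃ κ ∈ OB.powerset, B κ := by
    ext ω
    simp only [Set.mem_iUnion, exists_prop, Finset.mem_powerset, hB, Set.mem_inter_iff, Set.mem_setOf_eq]
    constructor
    · intro hω; exact ⟨L.Kont j ω, LData.Kont_subset j ω, hω, rfl⟩
    · rintro ⟨κ, -, hω, -⟩; exact hω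
  have hdecHD : L.Hev N J t j ∩ L.Djo j = ⋃ κ ∈ OB.powerset, (Op κ ∩ B κ) := by
    ext ω
    simp only [Set.mem_iUnion, exists_prop, Finset.mem_powerset, hB, hOp, Set.mem_inter_iff,
      Set.mem_setOf_eq, LData.Djo]
    constructor
    · rintro ⟨hω, hD⟩; exact ⟨L.Kont j ω, LData.Kont_subset j ω, hD, hω, rfl⟩
    · rintro ⟨κ, -, hD, hω, rfl⟩; exact ⟨hω, hD⟩
  have hdisjB : (↑OB.powerset : Set (Finset V)).PairwiseDisjoint B := by
    intro κ _ κ' _ hne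
    rw [Function.onFun, Set.disjoint_left]
    rintro ω ⟨-, h1⟩ ⟨-, h2⟩
    exact hne (h1.symm.trans h2)
  have hdisjOB : (↑OB.powerset : Set (Finset V)).PairwiseDisjoint fun κ => Op κ ∩ B κ := by
    intro κ hκ κ' hκ' hne
    exact (hdisjB hκ hκ' hne).mono Set.inter_subset_right Set.inter_subset_right
  rw [hdecHD, measureReal_biUnion_finset hdisjOB (fun κ _ => (hOpm κ).inter (hBm κ)),
    hdecH, measureReal_biUnion_finset hdisjB (fun κ _ => hBm κ), Finset.mul_sum]
  refine Finset.sum_le_sum fun κ hκ => ?_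
  rw [Finset.mem_powerset] at hκ
  -- independence of `Op κ` (fresh contact edges) from `B κ`
  have hind : μ.real (Op κ ∩ B κ) = μ.real (Op κ) * μ.real (B κ) := by
    rw [hμ]
    refine prodBernoulli_real_inter_of_determinedBy W (L.cEdges j κ) (hOpdet κ) ?_ (hOpm κ) (hBm κ)
    exact (hBdet κ).mono fun e he he' => LData.cEdges_disjoint_wireSet_region (Finset.mem_coe.1 he') he
  rw [hind]
  by_cases hcard : κ.card < N
  · exact mul_le_mul_of_nonneg_right (hOp_le κ hκ hcard) measureReal_nonneg
  · -- `B κ = ∅` since `H ⊆ Fail`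
    have hBempty : B κ = ∅ := by
      ext ω
      simp only [hB, Set.mem_inter_iff, Set.mem_setOf_eq, Set.mem_empty_iff_false, iff_false, not_and]
      rintro ⟨hF, -, -⟩ hK
      rw [LData.Fail, Set.mem_setOf_eq, hK] at hF
      exact hcard hF
    rw [hBempty, measureReal_empty, mul_zero, mul_zero]

/-- **`P(A_t) ≤ (1 - (1-p)^{ΔN})^t`** (eq. (17)–(18) of KN: "`P(G_1 ∩ ⋯ ∩ G_{k₂}) ≤ (1 - (1-p)^{…})^{k₂}`").
[cite: KozmaNitzan2024, §4 p. 18 ((17)–(18))] -/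
theorem real_Aev_le {Δ : ℕ} (hΔ : ∀ x, G.degree x ≤ Δ) {N : ℕ} {J : Finset ℕ} (hJ : ∀ j' ∈ J, j' ≤ R) (t : ℕ) :
    (prodBernoulli W).real (L.Aev N J t) ≤ (1 - (1 - (p : ℝ)) ^ (Δ * N)) ^ t := by
  classical
  set μ := prodBernoulli W with hμ
  set r : ℝ := 1 - (1 - (p : ℝ)) ^ (Δ * N) with hr
  have hr0 : 0 ≤ r := by
    rw [hr, sub_nonneg]
    exact pow_le_one₀ (sub_nonneg.2 p.2.2) (sub_le_self _ p.2.1)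
  induction t with
  | zero => rw [pow_zero]; exact measureReal_le_one
  | succ t ih =>
    calc μ.real (L.Aev N J (t + 1)) ≤ ∑ j ∈ J, μ.real (L.Hev N J t j ∩ L.Djo j) := by
          rw [LData.Aev_succ]; exact measureReal_biUnion_finset_le (μ := μ) J _
      _ ≤ ∑ j ∈ J, r * μ.real (L.Hev N J t j) :=
          Finset.sum_le_sum fun j hj => hL.real_Hev_inter_Djo_le hΔ hJ hj
      _ = r * μ.real (⋃ j ∈ J, L.Hev N J t j) := by
          rw [← Finset.mul_sum, measureReal_biUnion_finset (LData.Hev_pairwiseDisjoint t) (fun j _ => hL.measurableSet_Hev hJ t j)]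
      _ ≤ r * μ.real (L.Aev N J t) := by
          refine mul_le_mul_of_nonneg_left (measureReal_mono ?_) hr0
          exact Set.iUnion₂_subset fun j _ => LData.Hev_subset_Aev t j
      _ ≤ r * r ^ t := mul_le_mul_of_nonneg_left ih hr0
      _ = r ^ (t + 1) := by ring

open Classical in
/-- **On `{o ↔ B}`, `t` failure levels in `J` give `A_t`** (almost surely): all levels carry open contact edges (`reachB_subset_Djo`), so
the `t` outermost failure levels do. [cite: KozmaNitzan2024, §4 p. 18 ("X > k₂ implies G_1 ∩ ⋯ ∩ G_{k₂}")] -/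
theorem reachB_inter_subset_Aev {N : ℕ} {J : Finset ℕ} (hJ : ∀ j' ∈ J, j' ≤ R) {t : ℕ} (ht : 1 ≤ t) :
    L.reachB ∩ PosOnly W ∩ {ω | t ≤ (J.filter fun j => ω ∈ L.Fail N j).card} ⊆ L.Aev N J t := by
  rintro ω ⟨hω, hcard⟩
  simp only [Set.mem_setOf_eq] at hcard
  have hD : ∀ j ∈ J, ω ∈ L.Djo j := fun j hj => hL.reachB_subset_Djo (hJ j hj) hω
  -- strong induction on the number of failure levels above a failure level
  have key : ∀ n j, j ∈ J → ω ∈ L.Fail N j → (L.failAbove N J j ω).card = n →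
      ∀ t, 1 ≤ t → t ≤ n + 1 → ω ∈ L.Aev N J t := by
    intro n
    induction n with
    | zero =>
      intro j hj hF hc t ht1 htn
      obtain rfl : t = 1 := by omega
      simp only [LData.Aev, Set.mem_iUnion, exists_prop]
      exact ⟨j, hj, ⟨hF, hc, fun j' hj' _ _ => hD j' hj'⟩, hD j hj⟩
    | succ n ih =>
      intro j hj hF hc t ht1 htn
      rcases Nat.lt_or_ge t (n + 2) with hlt | hge
      · -- descend to the lowest failure level above `j`
        have hne : (L.failAbove N J j ω).Nonempty := by rw [← Finset.card_pos, hc]; omega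
        set m := (L.failAbove N J j ω).min' hne with hm
        have hm_mem := Finset.min'_mem _ hne
        rw [← hm] at hm_mem
        obtain ⟨hmJ, -, hmF⟩ := LData.mem_failAbove_iff.1 hm_mem
        have hcm : (L.failAbove N J m ω).card = n := by
          rw [hm, LData.failAbove_min' hne, Finset.card_erase_of_mem (hm ▸ hm_mem), hc]; rfl
        exact ih m hmJ hmF hcm t ht1 (by omega)
      · obtain rfl : t = n + 2 := by omega
        simp only [LData.Aev, Set.mem_iUnion, exists_prop]
        exact ⟨j, hj, ⟨hF, hc, fun j' hj' _ _ => hD j' hj'⟩, hD j hj⟩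
  set FS := J.filter fun j => ω ∈ L.Fail N j with hFS
  have hne : FS.Nonempty := by rw [← Finset.card_pos]; omega
  set m := FS.min' hne with hm
  have hm_mem := Finset.min'_mem _ hne
  rw [← hm] at hm_mem
  obtain ⟨hmJ, hmF⟩ := Finset.mem_filter.1 hm_mem
  have hfa : L.failAbove N J m ω = FS.erase m := by
    ext j''
    rw [LData.mem_failAbove_iff, Finset.mem_erase, hFS, Finset.mem_filter]
    constructor
    · rintro ⟨hJ'', hlt, hF''⟩; exact ⟨ne_of_gt hlt, hJ'', hF''⟩
    · rintro ⟨hne', hJ'', hF''⟩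
      refine ⟨hJ'', lt_of_le_of_ne (hm ▸ Finset.min'_le _ _ (Finset.mem_filter.2 ⟨hJ'', hF''⟩)) (Ne.symm hne'), hF''⟩
  have hc : (L.failAbove N J m ω).card = FS.card - 1 := by
    rw [hfa, Finset.card_erase_of_mem (hm ▸ hm_mem)]
  exact key _ m hmJ hmF hc t ht (by omega)

end LHyp

namespace LData

variable {L : LData G} {W : Sym2 V → unitInterval}

open Classical in
/-- **Counting the failure levels on an event**: `Σ_{j ∈ J} P(C ∩ Fail_j) = Σ_{t=1}^{|J|} P(C ∩ {t ≤ #failure levels})` (both are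
`E[#failures; C]`; KN p. 18: "`E(X) ≥ δ(R - 5M)`" versus "`P(X > k₂) < ½δ`"). [cite: KozmaNitzan2024, §4 p. 18 (the variable X)] -/
theorem sum_real_inter_Fail_eq (N : ℕ) (J : Finset ℕ) {C : Set (BondConfig V)} (hC : MeasurableSet C) :
    ∑ j ∈ J, (prodBernoulli W).real (C ∩ L.Fail N j) =
      ∑ t ∈ Finset.Icc 1 J.card, (prodBernoulli W).real (C ∩ {ω | t ≤ (J.filter fun j => ω ∈ L.Fail N j).card}) := by
  set μ := prodBernoulli W with hμ
  have hcount : ∀ t, MeasurableSet {ω : BondConfig V | t ≤ (J.filter fun j => ω ∈ L.Fail N j).card} := by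
    intro t
    have : {ω : BondConfig V | t ≤ (J.filter fun j => ω ∈ L.Fail N j).card} =
        ⋃ K ∈ J.powerset.filter (fun K => t ≤ K.card), ⋂ j ∈ J, {ω | ω ∈ L.Fail N j ↔ j ∈ K} := by
      ext ω
      simp only [Set.mem_setOf_eq, Set.mem_iUnion, Set.mem_iInter, Finset.mem_filter, Finset.mem_powerset,
        exists_prop]
      constructor
      · intro h
        refine ⟨J.filter fun j => ω ∈ L.Fail N j, ⟨Finset.filter_subset _ _, h⟩, fun j hj => ?_⟩
        simp [Finset.mem_filter, hj]
      · rintro ⟨K, ⟨hKJ, hK⟩, hiff⟩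
        have : J.filter (fun j => ω ∈ L.Fail N j) = K := by
          ext j
          simp only [Finset.mem_filter]
          constructor
          · rintro ⟨hj, hF⟩; exact (hiff j hj).1 hF
          · intro hjK; exact ⟨hKJ hjK, (hiff j (hKJ hjK)).2 hjK⟩
        rwa [this]
    rw [this]
    refine Finset.measurableSet_biUnion _ fun K _ => Finset.measurableSet_biInter _ fun j _ => ?_
    have h1 := measurableSet_Fail (L := L) N j
    by_cases hjK : j ∈ K
    · have : {ω : BondConfig V | ω ∈ L.Fail N j ↔ j ∈ K} = L.Fail N j := by
        ext ω; simp [hjK]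
      rw [this]; exact h1
    · have : {ω : BondConfig V | ω ∈ L.Fail N j ↔ j ∈ K} = (L.Fail N j)ᶜ := by
        ext ω; simp [hjK]
      rw [this]; exact h1.compl
  -- both sides are integrals of the same simple function
  have hL1 : ∀ j ∈ J, μ.real (C ∩ L.Fail N j) = ∫ ω, (C ∩ L.Fail N j).indicator (1 : BondConfig V → ℝ) ω ∂μ :=
    fun j _ => (integral_indicator_one (hC.inter (measurableSet_Fail (L := L) N j))).symm
  have hR1 : ∀ t ∈ Finset.Icc 1 J.card, μ.real (C ∩ {ω | t ≤ (J.filter fun j => ω ∈ L.Fail N j).card}) =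
      ∫ ω, (C ∩ {ω | t ≤ (J.filter fun j => ω ∈ L.Fail N j).card}).indicator (1 : BondConfig V → ℝ) ω ∂μ :=
    fun t _ => (integral_indicator_one (hC.inter (hcount t))).symm
  rw [Finset.sum_congr rfl hL1, Finset.sum_congr rfl hR1, ← integral_finsetSum, ← integral_finsetSum]
  · refine integral_congr_ae (Filter.Eventually.of_forall fun ω => ?_)
    show (∑ i ∈ J, (C ∩ L.Fail N i).indicator 1 ω) =
      ∑ i ∈ Finset.Icc 1 J.card, (C ∩ {ω | i ≤ (J.filter fun j => ω ∈ L.Fail N j).card}).indicator 1 ω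
    by_cases hω : ω ∈ C
    · have e1 : ∀ j ∈ J, (C ∩ L.Fail N j).indicator (1 : BondConfig V → ℝ) ω =
          if ω ∈ L.Fail N j then 1 else 0 := by
        intro j _
        simp only [Set.indicator_apply, Set.mem_inter_iff, hω, true_and, Pi.one_apply]
      have e2 : ∀ t ∈ Finset.Icc 1 J.card,
          (C ∩ {ω | t ≤ (J.filter fun j => ω ∈ L.Fail N j).card}).indicator (1 : BondConfig V → ℝ) ω =
            if t ≤ (J.filter fun j => ω ∈ L.Fail N j).card then 1 else 0 := by
        intro t _
        simp only [Set.indicator_apply, Set.mem_inter_iff, hω, true_and, Pi.one_apply, Set.mem_setOf_eq]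
      rw [Finset.sum_congr rfl e1, Finset.sum_congr rfl e2, Finset.sum_boole, Finset.sum_boole]
      congr 1
      set k := (J.filter fun j => ω ∈ L.Fail N j).card with hk
      have hkJ : k ≤ J.card := Finset.card_filter_le _ _
      have : (Finset.Icc 1 J.card).filter (fun t => t ≤ k) = Finset.Icc 1 k := by
        ext t; simp only [Finset.mem_filter, Finset.mem_Icc]; omega
      rw [this, Nat.card_Icc]
      omega
    · have e1 : ∀ j ∈ J, (C ∩ L.Fail N j).indicator (1 : BondConfig V → ℝ) ω = 0 := by
        intro j _
        simp only [Set.indicator_apply, Set.mem_inter_iff, hω, false_and, if_false]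
      have e2 : ∀ t ∈ Finset.Icc 1 J.card,
          (C ∩ {ω | t ≤ (J.filter fun j => ω ∈ L.Fail N j).card}).indicator (1 : BondConfig V → ℝ) ω = 0 := by
        intro t _
        simp only [Set.indicator_apply, Set.mem_inter_iff, hω, false_and, if_false]
      rw [Finset.sum_congr rfl e1, Finset.sum_congr rfl e2, Finset.sum_const_zero, Finset.sum_const_zero]
  · intro t _
    exact (integrable_const (1 : ℝ)).indicator (hC.inter (hcount t))
  · intro j _
    exact (integrable_const (1 : ℝ)).indicator (hC.inter (measurableSet_Fail (L := L) N j))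

end LData

namespace LHyp

variable {L : LData G} {W : Sym2 V → unitInterval} {p : unitInterval} {D : Finset V} {R : ℕ}
variable (hL : LHyp L W p D R)
include hL

open Classical in
/-- **Step II** (KN p. 18) over the levels of `G` (degrees `≤ Δ`, countably many vertices): if `P(o ↔ B) > 1 - δ` and the level range
`J = [j₀, j₁]`, `j₁ ≤ R`, has at least `(1-p)^{-ΔN} / δ` levels, then at some level `j ∈ J` there are at least `N` contact vertices with
probability `> 1 - 2δ`. [cite: KozmaNitzan2024, §4 p. 18 (Step II)] -/
theorem stepII [Countable V] {Δ : ℕ} (hΔ : ∀ x, G.degree x ≤ Δ) (hp1 : (p : ℝ) < 1) {N j₀ j₁ : ℕ} (hj₁ : j₁ ≤ R) {δ : ℝ}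
    (hJ : 1 / (1 - (p : ℝ)) ^ (Δ * N) ≤ δ * ((Finset.Icc j₀ j₁).card : ℝ))
    (hreach : 1 - δ < (prodBernoulli W).real L.reachB) :
    ∃ j ∈ Finset.Icc j₀ j₁, 1 - 2 * δ < (prodBernoulli W).real {ω | N ≤ (L.Kont j ω).card} := by
  simp only [← LData.compl_Fail_eq]
  set μ := prodBernoulli W with hμ
  set J := Finset.Icc j₀ j₁ with hJdef
  have hJle : ∀ j ∈ J, j ≤ R := fun j hj => (Finset.mem_Icc.1 hj).2.trans hj₁
  set q : ℝ := (1 - (p : ℝ)) ^ (Δ * N) with hq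
  have hq0 : 0 < q := pow_pos (by linarith) _
  have hq1 : q ≤ 1 := pow_le_one₀ (sub_nonneg.2 p.2.2) (sub_le_self _ p.2.1)
  set r : ℝ := 1 - q with hr
  have hr0 : 0 ≤ r := by rw [hr]; linarith
  have hr1 : r < 1 := by rw [hr]; linarith
  -- `J` is nonempty
  have hJne : J.Nonempty := by
    rw [← Finset.card_pos]
    by_contra h0
    push Not at h0
    have : (J.card : ℝ) = 0 := by exact_mod_cast Nat.le_zero.1 h0
    rw [this, mul_zero] at hJ
    have : 0 < 1 / q := by positivity
    linarith
  -- tails: `P(o ↔ B, t ≤ #fails) ≤ r^t`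
  have htail : ∀ t ∈ Finset.Icc 1 J.card,
      μ.real (L.reachB ∩ {ω | t ≤ (J.filter fun j => ω ∈ L.Fail N j).card}) ≤ r ^ t := by
    intro t ht
    have ht1 : 1 ≤ t := (Finset.mem_Icc.1 ht).1
    have hcov : L.reachB ∩ {ω | t ≤ (J.filter fun j => ω ∈ L.Fail N j).card} ⊆
        L.Aev N J t ∪ (PosOnly W)ᶜ := by
      intro ω hω
      by_cases hpos : ω ∈ PosOnly W
      · exact Or.inl (hL.reachB_inter_subset_Aev hJle ht1 ⟨⟨hω.1, hpos⟩, hω.2⟩)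
      · exact Or.inr hpos
    calc _ ≤ μ.real (L.Aev N J t ∪ (PosOnly W)ᶜ) := measureReal_mono hcov
      _ ≤ μ.real (L.Aev N J t) + μ.real (PosOnly W)ᶜ := measureReal_union_le _ _
      _ ≤ r ^ t := by rw [hμ, real_compl_posOnly W, add_zero]; exact hL.real_Aev_le hΔ hJle t
  -- the sum over levels is at most `1/q`
  have hsum : ∑ j ∈ J, μ.real (L.reachB ∩ L.Fail N j) ≤ 1 / q := by
    rw [hμ, LData.sum_real_inter_Fail_eq (L := L) N J LData.measurableSet_reachB]
    calc _ ≤ ∑ t ∈ Finset.Icc 1 J.card, r ^ t := Finset.sum_le_sum htail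
      _ ≤ ∑ t ∈ Finset.range (J.card + 1), r ^ t := by
          refine Finset.sum_le_sum_of_subset_of_nonneg (fun t ht => ?_) (fun t _ _ => pow_nonneg hr0 t)
          rw [Finset.mem_range]; rw [Finset.mem_Icc] at ht; omega
      _ = (r ^ (J.card + 1) - 1) / (r - 1) := geom_sum_eq hr1.ne _
      _ ≤ 1 / q := by
          have e1 : (r ^ (J.card + 1) - 1) / (r - 1) = (1 - r ^ (J.card + 1)) / q := by
            have hq' : r - 1 = -q := by rw [hr]; ring
            rw [hq', div_neg, ← neg_div, neg_sub]
          rw [e1]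
          exact div_le_div_of_nonneg_right (by linarith [pow_nonneg hr0 (J.card + 1)]) hq0.le
  -- some level has `P(o ↔ B, Fail_j) ≤ δ`
  obtain ⟨j, hj, hjle⟩ := Finset.exists_le_of_sum_le hJne
    (f := fun j => μ.real (L.reachB ∩ L.Fail N j)) (g := fun _ => (1 / q) / J.card) (by
      rw [Finset.sum_const, nsmul_eq_mul, mul_div_cancel₀ _ (by exact_mod_cast hJne.card_pos.ne')]
      exact hsum)
  refine ⟨j, hj, ?_⟩
  have hjδ : μ.real (L.reachB ∩ L.Fail N j) ≤ δ := by
    refine hjle.trans ?_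
    rw [div_le_iff₀ (by exact_mod_cast hJne.card_pos)]
    exact hJ
  -- `P(Fail_jᶜ) ≥ P(o ↔ B) - P(o ↔ B, Fail_j)`
  have hsplit : μ.real L.reachB ≤ μ.real (L.reachB ∩ L.Fail N j) + μ.real (L.Fail N j)ᶜ := by
    rw [← measureReal_inter_add_sdiff (s := L.reachB) (LData.measurableSet_Fail (L := L) N j)]
    refine add_le_add le_rfl (measureReal_mono fun ω hω => hω.2)
  linarith

end LHyp

end KNLevels

end Transplant

end Summit.CriticalPhenomena.PercolationContinuityZ3.Theorems

end
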